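import Summits.BirchSwinnertonDyer.BirchSwinnertonDyer.Theorems.ManinLocalTwoThreeCDivisionIntegralCDT
import Summits.BirchSwinnertonDyer.Rank1Residual.ManinAdditive.ShimuraKernelCyclic
import Literature.NumberTheory.EllipticCurves.ModularSymbolsEichlerShimuraHoldsProofs
import HarnessLib

/-!
# REF1 §R217 — `ManinConstantOne` ⟸ CDT Thm 1 ∧ «Λ₀(f)/Λ₁(f) cyclic» (turnkey evidence; a prover/typer lands it)

With the tree's kernel theorem `CDivisionInt.periodLatticeGamma1_le_neron_of_CDTInt` (CDT Thm 1 ⟹ Stevens I strong: `Λ₁(f) ⊆ Λ_W`)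
and lattice-optimality `Λ_W = c·Λ₀(f)`, one gets `Λ₁(f) ⊆ c·Λ₀(f)`, so `Λ₀/cΛ₀ ≅ (ℤ/c)²` is a quotient of `Λ₀/Λ₁`; if the latter is CYCLIC
(desc g26 row E-desc-g26-2 `ShimuraKernelCyclic`, MEMO-desc §51.6 COROLLARY CYC — a `@[conjecture]` row, paper theorem candidate) then
`|c| = 1`.  Hence **the whole of Manin's conjecture `ManinConstantOne` follows from CDT and `ShimuraKernelCyclic` alone** — no Mazur 1978 /
Abbes–Ullmo 1996 / Česnavičius 2018 input.  CONDITIONAL implication; nothing is proved unconditionally; BSD is not touched.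
v2: the hypothesis is desc's LANDED tree row `ShimuraCyclic.ShimuraKernelCyclic` (p757953, `…/ManinAdditive/ShimuraKernelCyclic.lean`
19c0c2855c3b7e0d l.82) BY NAME (v1 6823bf6af7cbb8fa stated its body inline before the landing; kept as ProofCycManin-v1-inline.lean).

TYPER NOTE (typer g21, ref1 §R217 TURNKEY A-ref1-217-1).  SOURCE = HOME/ref1/e217/ProofCycManin.lean sha16 c9fb03f65a990960 (93 l.; ref1: farm
rc 0·0·0·0, std axioms; «refuter does not land positives» — evidence on stmt-BirchSwinnertonDyer-22967 for -ty/LEAD, ref1 offered «APPEND to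
ShimuraKernelCyclicSplit.lean or new ManinConstantOneOfCDTCyclic.lean»; landed as the NEW file so as not to queue behind a pending append on the
Split file) VERBATIM, with exactly these deltas: namespace `…ManinAdditive.Ref1R217` → `…ManinAdditive.ShimuraCyclic` (the namespace of the row it
consumes, so the theorem reads `ShimuraCyclic.maninConstantOne_of_CDTInt_shimuraKernelCyclic`); the trailing `#assert_std_axioms` command elaborator
(source ll. 84–93) dropped — the gate audits axioms itself; this note.  CONE SIDE by construction (imports
`Theorems.ManinLocalTwoThreeCDivisionIntegralCDT`, inside the `Theses.ManinLocalTwoThree` import cone) + the route-independent leaf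
`…ManinAdditive.ShimuraKernelCyclic` (row `ShimuraCyclic.ShimuraKernelCyclic`, p757953) + Literature `ModularSymbolsEichlerShimuraHoldsProofs`
(`isZLattice_periodLattice_holds`); theorem-only (kind proof), no statement introduced; no tree declaration of this name or statement at landing
(rg 03:5xZ).  PRICING (director 00:56Z freeze): a CONDITIONAL implication «ManinConstantOne ⟸ CDT ∧ ShimuraKernelCyclic» — CDT =
`CalegariDimitrovTang2025_unboundedDenominators` is a registered printed fact taken as a hypothesis, `ShimuraKernelCyclic` is an OPEN @[conjecture] row;
Manin c = 1 is NOT proved by this, BSD is proved for no curve by this; C2/C3/C4 OPEN.  bears_on: stmt-BirchSwinnertonDyer-22967 / 22968 / 22969.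
[cite: CalegariDimitrovTang2025, Thm. 1.0.1]
-/

open Literature.NumberTheory.EllipticCurves Literature.NumberTheory.EllipticCurves.ModularForms
open Literature.NumberTheory.Automorphic
open Summit.BirchSwinnertonDyer.BirchSwinnertonDyer.Theorems.ManinLocalTwoThree
open Summit.BirchSwinnertonDyer.Rank1Residual.ManinAdditive

namespace Summit.BirchSwinnertonDyer.Rank1Residual.ManinAdditive.ShimuraCyclic

/-- **Manin's conjecture ⟸ CDT Thm 1 ∧ cyclic Shimura kernel.** -/
theorem maninConstantOne_of_CDTInt_shimuraKernelCyclic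
    (hCDT : CalegariDimitrovTang2025_unboundedDenominators) (hcyc : ShimuraCyclic.ShimuraKernelCyclic) :
    Summit.BirchSwinnertonDyer.Rank1Residual.ManinConstant.ManinConstantOne := by
  intro W _ _ N _ D hopt
  have hle := CDivisionInt.periodLatticeGamma1_le_neron_of_CDTInt hCDT D
  obtain ⟨z₀, hz₀, hcy⟩ := hcyc W D
  have hf : IsNewform0 D.f := D.isNewformOf.1
  have hQ : coeffField D.f = ⊥ := IsNewformOf.coeffField_eq_bot D.isNewformOf
  obtain ⟨hdisc, hZ⟩ := isZLattice_periodLattice_holds (f := D.f) hf hQ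
  haveI : DiscreteTopology ↥(AddSubgroup.toIntSubmodule (periodLattice D.f)) := hdisc
  haveI : IsZLattice ℝ (AddSubgroup.toIntSubmodule (periodLattice D.f)) := hZ
  haveI : Module.Free ℤ ↥(AddSubgroup.toIntSubmodule (periodLattice D.f)) :=
    ZLattice.module_free ℝ (AddSubgroup.toIntSubmodule (periodLattice D.f))
  haveI : Module.Finite ℤ ↥(AddSubgroup.toIntSubmodule (periodLattice D.f)) :=
    ZLattice.module_finite ℝ (AddSubgroup.toIntSubmodule (periodLattice D.f))
  have hrank : Module.finrank ℤ ↥(AddSubgroup.toIntSubmodule (periodLattice D.f)) = 2 := by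
    rw [ZLattice.rank ℝ (AddSubgroup.toIntSubmodule (periodLattice D.f)), Complex.finrank_real_complex]
  set c : ℤ := D.c with hc
  -- `Λ₀ ⊆ ℤ z₀ + c Λ₀` inside the lattice
  let z₀' : ↥(AddSubgroup.toIntSubmodule (periodLattice D.f)) := ⟨z₀, hz₀⟩
  have key : ∀ z : ↥(AddSubgroup.toIntSubmodule (periodLattice D.f)),
      ∃ (k : ℤ) (w : ↥(AddSubgroup.toIntSubmodule (periodLattice D.f))), z = k • z₀' + c • w := by
    intro z
    obtain ⟨k, w, hw₁, hz⟩ := hcy z z.2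
    obtain ⟨w', hw', hw⟩ := hopt w (hle w hw₁)
    refine ⟨k, ⟨w', hw'⟩, Subtype.ext ?_⟩
    simp [z₀', zsmul_eq_mul, hz, hw, hc]
  -- a `ℤ`-basis with two distinct indices
  let b := Module.Free.chooseBasis ℤ ↥(AddSubgroup.toIntSubmodule (periodLattice D.f))
  have hcard : Fintype.card (Module.Free.ChooseBasisIndex ℤ ↥(AddSubgroup.toIntSubmodule (periodLattice D.f))) = 2 := by
    rw [← Module.finrank_eq_card_chooseBasisIndex, hrank]
  obtain ⟨i, j, hij⟩ := Fintype.exists_pair_of_one_lt_card (α :=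
    Module.Free.ChooseBasisIndex ℤ ↥(AddSubgroup.toIntSubmodule (periodLattice D.f))) (by omega)
  obtain ⟨ki, wi, hi⟩ := key (b i)
  obtain ⟨kj, wj, hj⟩ := key (b j)
  have e1 := congrArg (fun v => b.repr v i) hi
  have e2 := congrArg (fun v => b.repr v j) hi
  have e3 := congrArg (fun v => b.repr v i) hj
  have e4 := congrArg (fun v => b.repr v j) hj
  simp only [b.repr_self, map_add, map_zsmul, Finsupp.add_apply, Finsupp.smul_apply, smul_eq_mul,
    Finsupp.single_apply, if_true, if_neg hij, if_neg (Ne.symm hij)] at e1 e2 e3 e4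
  -- mod `c`: `ki p ≡ 1`, `ki q ≡ 0`, `kj p ≡ 0`, `kj q ≡ 1`, and `(ki p)(kj q) = (ki q)(kj p)` ⟹ `c ∣ 1`
  have f1 : ki * b.repr z₀' i = 1 - c * b.repr wi i := by linarith [e1]
  have f2 : ki * b.repr z₀' j = -(c * b.repr wi j) := by linarith [e2]
  have f3 : kj * b.repr z₀' i = -(c * b.repr wj i) := by linarith [e3]
  have f4 : kj * b.repr z₀' j = 1 - c * b.repr wj j := by linarith [e4]
  have hmul : (ki * b.repr z₀' i) * (kj * b.repr z₀' j) = (ki * b.repr z₀' j) * (kj * b.repr z₀' i) := by ring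
  rw [f1, f2, f3, f4] at hmul
  have hunit : c * (b.repr wi i + b.repr wj j - c * (b.repr wi i) * (b.repr wj j) + c * (b.repr wi j) * (b.repr wj i)) = 1 := by
    linear_combination (-1 : ℤ) * hmul
  have h1 : c = 1 ∨ c = -1 := Int.eq_one_or_neg_one_of_mul_eq_one hunit
  show |D.maninConstant| = 1
  have : D.maninConstant = c := rfl
  rw [this]
  rcases h1 with h | h <;> simp [h]

end Summit.BirchSwinnertonDyer.Rank1Residual.ManinAdditive.ShimuraCyclic
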